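import Summits.QuantumAdvantage.AdviceFreeQNC0.CombGateJ37Fibre
import HarnessLib

/-!
# Cell qa-qnc0 — THE COMB THEOREM for a 3-separated candidate set of polylog size (2/3): counting

Cell qa-qnc0, crux stmt-QuantumAdvantage-22907 (route DWalkThree).  AUTHORED AND PROVED BY THE PLANNER qa-qnc0-p1 gen 36 (ROUND-35 §4.10 (7)(8′), INBOX 14:05Z/14:12Z, evidence #53 on stmt-22907, file `HOME/qa-qnc0-p1/exp36/CombGateJ37.lean` v3, 840 lines, rc 0 / 0 sorries); landed verbatim by qn-prover-3 g21 as a mechanical three-way split (≤ 400 lines each): `CombGateJ37Fibre` (flips, candidates, Steps 2a–2c) → `CombGateJ37Count` (Steps 1, 3) → `CombGateJ37` (Steps 4–7: `comb_leJ`, `gateSum_flipAt`, `gateGated_leJ`, `exists_isComb_sub`, `denseGate_le`, `three_window`).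

This part: Step 1 — weighted double counting over backgrounds (`agree_symm`, `sum_weights`, `card_eq_sum_fibres`); Step 3 — few
backgrounds have few good candidates (`BadOn`, `nbEq_flip_succ`, `card_badOn`, `card_fewGood_le`, `choose_mul_pow_le`).
-/

noncomputable section

open Classical

namespace Summit.QuantumAdvantage.AdviceFreeQNC0

open Finset
open Literature.Computability.MetaComplexity Literature.Computability.MetaComplexity.Smolensky
open AffBells22 Subcube

namespace Comb37J

variable {n : ℕ}
variable {J : Finset (Fin n)}

/-! ### Step 1: weighted double counting over backgrounds -/

/-- Agreement off the good candidates is symmetric. -/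
theorem agree_symm (hJ : IsComb J) {rel : Fin n → Bool} {a u : Fin n → Bool}
    (h : ∀ i ∈ Wset J rel a, u i = a i) : ∀ i ∈ Wset J rel u, a i = u i := by
  intro i hi
  rw [Wset_congr hJ h] at hi
  exact (h i hi).symm

/-- The cardinality of a filter as a real indicator sum. -/
theorem card_filter_real {α : Type*} (s : Finset α) (p : α → Prop) [DecidablePred p] :
    ((s.filter p).card : ℝ) = ∑ x ∈ s, if p x then (1 : ℝ) else 0 := by
  rw [Finset.card_filter, Nat.cast_sum]
  refine sum_congr rfl fun x _ => ?_
  split_ifs <;> simp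

/-- the weights of the backgrounds whose fibre contains `u` sum to one. -/
theorem sum_weights (hJ : IsComb J) (rel : Fin n → Bool) (u : Fin n → Bool) :
    ∑ a : Fin n → Bool, (if (∀ i ∈ Wset J rel a, u i = a i) then (1 : ℝ) / (2 : ℝ) ^ (Good J rel a).card else 0) = 1 := by
  have e : ∀ a : Fin n → Bool, (if (∀ i ∈ Wset J rel a, u i = a i) then (1 : ℝ) / (2 : ℝ) ^ (Good J rel a).card else 0)
      = if (∀ i ∈ Wset J rel u, a i = u i) then (1 : ℝ) / (2 : ℝ) ^ (Good J rel u).card else 0 := by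
    intro a
    by_cases h : ∀ i ∈ Wset J rel a, u i = a i
    · rw [if_pos h, if_pos (agree_symm hJ h), good_congr hJ h]
    · have h' : ¬ ∀ i ∈ Wset J rel u, a i = u i := fun h' => h (agree_symm hJ h')
      rw [if_neg h, if_neg h']
  rw [Finset.sum_congr rfl fun a _ => e a, ← Finset.sum_filter, sum_const, nsmul_eq_mul, card_agree (Wset J rel u) u,
    card_Wset]
  push_cast
  rw [mul_one_div]
  exact div_self (pow_ne_zero _ (by norm_num))

/-- **Double counting.**  `#{u : Q u} = Σ_a #{u : u = a on Wset J rel a, Q u} / 2^{|Good J rel a|}`. -/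
theorem card_eq_sum_fibres (hJ : IsComb J) (rel : Fin n → Bool) (Q : (Fin n → Bool) → Prop) [DecidablePred Q] :
    ((univ.filter fun u : Fin n → Bool => Q u).card : ℝ) = ∑ a : Fin n → Bool,
      ((univ.filter fun u : Fin n → Bool => (∀ i ∈ Wset J rel a, u i = a i) ∧ Q u).card : ℝ) /
        (2 : ℝ) ^ (Good J rel a).card := by
  have inner : ∀ a : Fin n → Bool,
      ((univ.filter fun u : Fin n → Bool => (∀ i ∈ Wset J rel a, u i = a i) ∧ Q u).card : ℝ) /
          (2 : ℝ) ^ (Good J rel a).card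
        = ∑ u : Fin n → Bool, (if Q u then
            (if (∀ i ∈ Wset J rel a, u i = a i) then (1 : ℝ) / (2 : ℝ) ^ (Good J rel a).card else 0) else 0) := by
    intro a
    rw [card_filter_real, Finset.sum_div]
    refine Finset.sum_congr rfl fun u _ => ?_
    by_cases hQ : Q u
    · by_cases hA : ∀ i ∈ Wset J rel a, u i = a i
      · rw [if_pos ⟨hA, hQ⟩, if_pos hQ, if_pos hA]
      · rw [if_neg (fun h => hA h.1), if_pos hQ, if_neg hA, zero_div]
    · rw [if_neg (fun h => hQ h.2), if_neg hQ, zero_div]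
  rw [Finset.sum_congr rfl fun a _ => inner a, Finset.sum_comm, card_filter_real]
  refine Finset.sum_congr rfl fun u _ => ?_
  by_cases hQ : Q u
  · simp only [hQ, if_true]
    exact (sum_weights hJ rel u).symm
  · simp [hQ]

/-! ### Step 3: few backgrounds have few good candidates -/

/-- all candidates in `S` are bad for `a`. -/
def BadOn (rel : Fin n → Bool) (S : Finset (Fin n)) (a : Fin n → Bool) : Prop := ∀ j ∈ S, nbEq a j ≠ rel j

/-- flipping the right neighbour toggles the neighbour bit of `j` … -/
theorem nbEq_flip_succ (hJ : IsComb J) {a : Fin n → Bool} {j : Fin n} (hj : j ∈ J) :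
    nbEq (flipAt a ⟨j.val + 1, hJ.succ_lt j hj⟩) j = !nbEq a j := by
  have hj2 := hJ.succ_lt j hj
  have h1 : j.val - 1 < n := by omega
  unfold nbEq uExt
  rw [dif_pos h1, dif_pos hj2, dif_pos h1, dif_pos hj2]
  have hne : (⟨j.val - 1, h1⟩ : Fin n) ≠ ⟨j.val + 1, hj2⟩ := by
    intro h; have := congrArg Fin.val h; simp only at this; omega
  rw [flipAt_ne _ hne, flipAt_self]
  cases a ⟨j.val - 1, h1⟩ <;> cases a ⟨j.val + 1, hj2⟩ <;> rfl

/-- … and no other candidate's (candidates are `≡ 1 (mod 3)`). -/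
theorem nbEq_flip_succ_ne (hJ : IsComb J) {a : Fin n → Bool} {j j' : Fin n} (hj : j ∈ J) (hj' : j' ∈ J)
    (hne : j' ≠ j) : nbEq (flipAt a ⟨j.val + 1, hJ.succ_lt j hj⟩) j' = nbEq a j' := by
  have h0 := hJ.succ_lt j hj
  have h0' := hJ.succ_lt j' hj'
  have h1 : j'.val - 1 < n := by omega
  have hvne : j'.val ≠ j.val := fun h => hne (Fin.ext h)
  have hfar : j.val + 3 ≤ j'.val ∨ j'.val + 3 ≤ j.val := by
    rcases Nat.lt_or_gt_of_ne hvne with hlt | hlt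
    · exact Or.inr (hJ.sep j' hj' j hj hlt)
    · exact Or.inl (hJ.sep j hj j' hj' hlt)
  unfold nbEq uExt
  rw [dif_pos h1, dif_pos h0', dif_pos h1, dif_pos h0']
  have hA : (⟨j'.val - 1, h1⟩ : Fin n) ≠ ⟨j.val + 1, h0⟩ := by
    intro h; have := congrArg Fin.val h; simp only at this; omega
  have hB : (⟨j'.val + 1, h0'⟩ : Fin n) ≠ ⟨j.val + 1, h0⟩ := by
    intro h; have := congrArg Fin.val h; simp only at this; omega
  rw [flipAt_ne _ hA, flipAt_ne _ hB]

/-- **Halving.**  `#{a : all of S bad} = 2^{n − |S|}` for `S ⊆ J`. -/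
theorem card_badOn (hJ : IsComb J) (rel : Fin n → Bool) (S : Finset (Fin n)) (hS : S ⊆ J) :
    (univ.filter fun a : Fin n → Bool => BadOn rel S a).card = 2 ^ (n - S.card) := by
  revert hS
  refine Finset.induction_on S ?_ ?_
  · intro _
    have : (univ.filter fun a : Fin n → Bool => BadOn rel ∅ a) = univ :=
      filter_true_of_mem fun a _ => fun j hj => absurd hj (by simp)
    rw [this, card_univ, Fintype.card_fun, Fintype.card_bool, Fintype.card_fin, card_empty, Nat.sub_zero]
  · intro j S hjS ih hS
    have hj : j ∈ J := hS (mem_insert_self _ _)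
    have hS' : S ⊆ J := fun x hx => hS (mem_insert_of_mem hx)
    have ihS := ih hS'
    set k : Fin n := ⟨j.val + 1, hJ.succ_lt j hj⟩ with hk
    set A1 := univ.filter fun a : Fin n → Bool => BadOn rel S a ∧ nbEq a j ≠ rel j with hA1
    set A2 := univ.filter fun a : Fin n → Bool => BadOn rel S a ∧ nbEq a j = rel j with hA2
    have hsplit : A2.card + A1.card = 2 ^ (n - S.card) := by
      rw [← ihS]
      have e1 : A2 = (univ.filter fun a : Fin n → Bool => BadOn rel S a).filter (fun a => nbEq a j = rel j) := by
        rw [hA2, filter_filter]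
      have e2 : A1 = (univ.filter fun a : Fin n → Bool => BadOn rel S a).filter
          (fun a => ¬ nbEq a j = rel j) := by
        rw [hA1, filter_filter]
      rw [e1, e2, card_filter_add_card_filter_not]
    have hmap : ∀ a : Fin n → Bool, BadOn rel S a → BadOn rel S (flipAt a k) := by
      intro a ha j' hj'S
      have hj'ne : j' ≠ j := fun h => hjS (h ▸ hj'S)
      rw [hk, nbEq_flip_succ_ne hJ hj (hS' hj'S) hj'ne]
      exact ha j' hj'S
    have hinj : ∀ a₁ a₂ : Fin n → Bool, flipAt a₁ k = flipAt a₂ k → a₁ = a₂ := by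
      intro a₁ a₂ h
      have := congrArg (fun b => flipAt b k) h
      simp only [flipAt_flipAt] at this
      exact this
    have h12 : A1.card ≤ A2.card := by
      refine card_le_card_of_injOn (fun a => flipAt a k) (fun a ha => ?_) (fun a₁ _ a₂ _ h => hinj a₁ a₂ h)
      rw [Finset.mem_coe, hA1, mem_filter] at ha
      rw [Finset.mem_coe, hA2, mem_filter]
      refine ⟨mem_univ _, hmap a ha.2.1, ?_⟩
      rw [hk, nbEq_flip_succ hJ hj]
      have h := ha.2.2
      revert h
      cases nbEq a j <;> cases rel j <;> simp
    have h21 : A2.card ≤ A1.card := by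
      refine card_le_card_of_injOn (fun a => flipAt a k) (fun a ha => ?_) (fun a₁ _ a₂ _ h => hinj a₁ a₂ h)
      rw [Finset.mem_coe, hA2, mem_filter] at ha
      rw [Finset.mem_coe, hA1, mem_filter]
      refine ⟨mem_univ _, hmap a ha.2.1, ?_⟩
      rw [hk, nbEq_flip_succ hJ hj]
      have h := ha.2.2
      revert h
      cases nbEq a j <;> cases rel j <;> simp
    have hins : (univ.filter fun a : Fin n → Bool => BadOn rel (insert j S) a) = A1 := by
      rw [hA1]
      refine filter_congr fun a _ => ?_
      constructor
      · intro h; exact ⟨fun j' hj' => h j' (mem_insert_of_mem hj'), h j (mem_insert_self _ _)⟩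
      · rintro ⟨h1, h2⟩ j' hj'
        rw [mem_insert] at hj'
        rcases hj' with rfl | hj'
        · exact h2
        · exact h1 j' hj'
    rw [hins, card_insert_of_notMem hjS]
    have hSn : S.card + 1 ≤ n := by
      have h := card_le_univ (insert j S)
      rw [card_insert_of_notMem hjS, Fintype.card_fin] at h
      exact h
    have e : 2 ^ (n - S.card) = 2 * 2 ^ (n - (S.card + 1)) := by
      rw [← pow_succ']; congr 1; omega
    rw [e] at hsplit
    generalize 2 ^ (n - (S.card + 1)) = X at hsplit ⊢
    omega

/-- **Union bound.**  `#{a : |Good J rel a| ≤ t} ≤ C(K, t)·2^{n − (K − t)}`, `K = |J|`. -/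
theorem card_fewGood_le (hJ : IsComb J) (rel : Fin n → Bool) {t : ℕ} (ht : t ≤ J.card) :
    (univ.filter fun a : Fin n → Bool => (Good J rel a).card ≤ t).card ≤
      (J.card).choose t * 2 ^ (n - (J.card - t)) := by
  set K := J.card with hK
  set s := K - t with hs
  have hcover : (univ.filter fun a : Fin n → Bool => (Good J rel a).card ≤ t) ⊆
      (J.powersetCard s).biUnion (fun S => univ.filter fun a : Fin n → Bool => BadOn rel S a) := by
    intro a ha
    rw [mem_filter] at ha
    rw [mem_biUnion]
    have hbad : s ≤ (J \ Good J rel a).card := by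
      rw [card_sdiff_of_subset (good_sub rel a)]
      omega
    obtain ⟨S, hSsub, hScard⟩ := exists_subset_card_eq hbad
    refine ⟨S, mem_powersetCard.2 ⟨fun x hx => (mem_sdiff.1 (hSsub hx)).1, hScard⟩,
      mem_filter.2 ⟨mem_univ _, ?_⟩⟩
    intro j hj heq
    have hj' := mem_sdiff.1 (hSsub hj)
    exact hj'.2 (mem_filter.2 ⟨hj'.1, heq⟩)
  calc (univ.filter fun a : Fin n → Bool => (Good J rel a).card ≤ t).card
      ≤ ((J.powersetCard s).biUnion
          (fun S => univ.filter fun a : Fin n → Bool => BadOn rel S a)).card := card_le_card hcover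
    _ ≤ ∑ S ∈ J.powersetCard s, (univ.filter fun a : Fin n → Bool => BadOn rel S a).card :=
        card_biUnion_le
    _ = ∑ S ∈ J.powersetCard s, 2 ^ (n - s) := by
        refine sum_congr rfl fun S hS => ?_
        rw [mem_powersetCard] at hS
        rw [card_badOn hJ rel S hS.1, hS.2]
    _ = K.choose t * 2 ^ (n - s) := by
        rw [sum_const, smul_eq_mul, card_powersetCard]
        congr 1
        rw [hs]
        exact Nat.choose_symm ht

/-- the numerical side condition: `C(K,t)·2^{n−(K−t)} ≤ 2^{n−1}` once `(L+2)t + 1 ≤ K ≤ n < 2^{L+1}`. -/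
theorem choose_mul_pow_le {K t L n : ℕ} (hKn : K ≤ n) (hn : n < 2 ^ (L + 1)) (ht : (L + 2) * t + 1 ≤ K) :
    K.choose t * 2 ^ (n - (K - t)) ≤ 2 ^ (n - 1) := by
  have hP : (L + 2) * t = (L + 1) * t + t := by ring
  have h1 : K.choose t ≤ K ^ t := Nat.choose_le_pow K t
  have h2 : K ^ t ≤ (2 ^ (L + 1)) ^ t := Nat.pow_le_pow_left (by omega) t
  calc K.choose t * 2 ^ (n - (K - t)) ≤ (2 ^ (L + 1)) ^ t * 2 ^ (n - (K - t)) :=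
        Nat.mul_le_mul_right _ (le_trans h1 h2)
    _ = 2 ^ ((L + 1) * t + (n - (K - t))) := by rw [← pow_mul, ← pow_add]
    _ ≤ 2 ^ (n - 1) := by
        apply Nat.pow_le_pow_right (by norm_num)
        rw [hP] at ht
        generalize (L + 1) * t = P at ht ⊢
        omega

end Comb37J

end Summit.QuantumAdvantage.AdviceFreeQNC0
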